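/-
Copyright (c) 2026 the pub-hodgecm-mathlib formalisation cell (harness21).  Prover seat hodgecm-mathlib-K2E3-p25 (g3) (L4 architect), HCML Track B «K2-LIT» ∕ h413
(`stmt-HodgeConjecture-24833`).  NR-1′ «LeThree SWEEP» (director s1979∕s1980): the hHC∕hHCB-binding theorems of ★ `F0P3cStCharTSHbOnMc` RE-READ under the NARROWED letters
hHC₃ `characterLocallyIntegrableLeThree` ∕ hHCB₃ `normalizedCharacter_locallyBoundedLeThree` (`2 ≤ N ≤ 3`, `v` non-split) — SAME NAMES, namespace `…K2E3HbOnMcLeThree`.  2026-09-04.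
-/
import Summits.HodgeConjecture.HodgeConjecture.Theorems.F0P3cStCharTSVanDijkHC         -- (F0P3a-p07 (g17)) «VDW-CORE» file 2: (A6) `norm_ofReal_vanDijkWeight_re_mul_le_of_hcBound` (over (A4) the junction `√√‖u‖ = Re Δ`, (A5), and `Δ = 0` off the regular set); brings file 1 `…VanDijkCore`
import Summits.HodgeConjecture.HodgeConjecture.Theorems.F0P3cStCharTSTorusChartIso     -- ★ p849607 `continuous_torusChart`
import Summits.HodgeConjecture.HodgeConjecture.Theorems.F0P3cStCharTSTorusCompactPart  -- ★ p849333 `isCompact_torusCompactPart` (`M_c = 𝒪_vˣ × E¹_v` compact at a non-split `v`)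
import Literature.NumberTheory.Rogawski1990.Ch12Sec7CharacterInputs                    -- ★ p850727 (F-b) the NAMED FACT `normalizedCharacter_locallyBounded` [HarishChandra1999 Thm. 16.3] (UNPROVED ⇒ a hypothesis here)
import Literature.NumberTheory.Rogawski1990.Ch12Sec5Inputs                             -- ★ (M1) `EllipticData.CharRegularity`
import Literature.NumberTheory.Automorphic.LocalUnitaryGroupCongr                      -- ★ `antidiagOne_isHermitian`, `isUnit_antidiagOne_det` (the antecedents of (F-b) at `Φ₃`)
import HarnessLib
import Summits.HodgeConjecture.HodgeConjecture.Theorems.F0P3cStCharTSHbOnMc   -- ★ the original: every non-letter lemma REUSED by qualified name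
import Summits.HodgeConjecture.HodgeConjecture.Theorems.K2E3CharLettersLeThreeDefs   -- NR-1′ root: hHC₃ ∕ hHCB₃

/-!
# NR-1′ twin — ★ `F0P3cStCharTSHbOnMc` under the narrowed Harish-Chandra letters (`2 ≤ N ≤ 3`, `v` non-split)

Cell `pub/hodgecm-mathlib`, crux H413 = `stmt-HodgeConjecture-24833`, line L4 `stub_StCharTS`; director rulings NR-1′ (s1979) ∕ «GO — LeThree SWEEP» (s1980); architect memo
`K2/K2E3-p25/g3/NR1-narrowing-cone.K2E3-p25-g3.md`.  THEOREMS ONLY; count-neutral helper (`--supports stmt-HodgeConjecture-24833 --as helper`).  Exactly the theorems of the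
original ★ file whose statements bind `Ch1.characterLocallyIntegrable` ∕ `normalizedCharacter_locallyBounded`, copied with the binder TYPE replaced by hHC₃ ∕ hHCB₃
(★ `K2E3CharLettersLeThreeDefs`), the rank∕non-split arguments supplied at each application (`2 ≤ N`, `N ≤ 3` by `norm_num`; the organ's `∀ w ∣ v, conj • w = w`), an added `hns`
binder where the original head was place-agnostic, and calls into other cone files re-pointed to their twins; every other lemma of the original is used BY QUALIFIED NAME.
No new mathematics.  The original ★ declarations are untouched.

HONEST LABEL: HC_CM is proved only modulo the 7 printed citations (2 remaining named inputs: hLiu418 = `stmt-HodgeConjecture-24832`, h413 = `stmt-HodgeConjecture-24833`) until rung 0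
closes; count-neutral; CONDITIONAL on the narrowed letters (stated, not assumed).

## References
* [Rogawski1990] J. D. Rogawski, *Automorphic Representations of Unitary Groups in Three Variables* (1990), §1.6 p. 5; §4.9 p. 54; §12.5–12.7.
* [HarishChandra1999AdmissibleDistributions] Harish-Chandra, *Admissible Invariant Distributions on Reductive p-adic Groups*, ULS 16 (1999), Thm. 16.3.
-/

set_option autoImplicit false
-- the mandated namespace has the single-problem summit's repeated segment (`HodgeConjecture.HodgeConjecture`)
set_option linter.dupNamespace false

noncomputable section

open MeasureTheory Filter Topology
open NumberField IsDedekindDomain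
open scoped NNReal
open Literature.NumberTheory.Automorphic Literature.NumberTheory.Automorphic.UnitaryGroup Literature.NumberTheory.Rogawski1990

open Summit.HodgeConjecture.HodgeConjecture.Cruxes.H413.K2E3CharLettersLeThreeDefs

namespace Summit.HodgeConjecture.HodgeConjecture.Cruxes.H413.K2E3HbOnMcLeThree

open F0P3cStCharTSTorusDefs

variable (L : Type) [Field L] [NumberField L] [IsCMField L] (v : HeightOneSpectrum (𝓞 ↥(maximalRealSubfield L)))

/-! ## §1 Harish-Chandra's bound read through van Dijk's weight on the diagonal torus -/

/-- **`‖Re Δ(t) · Θ(t)‖` is bounded on every compact set**, for `Θ` a Harish-Chandra character function of an irreducible class of `U(Φ₃)(L⁺_v)` ((M1)-clauses: locally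
integrable, locally constant at the regular points, representing the trace), GIVEN the named fact (F-b) ★ `normalizedCharacter_locallyBoundedLeThree` (hypothesis `hHC`).  Regular `t`:
(F-b)'s weight `√√‖u‖`, `u·det² = disc`, IS `Re Δ(t)`, and `Δ(t) = 0` at non-regular `t` — both packaged in «VDW-CORE» (A6) ★ `F0P3cStCharTSVanDijkHC.norm_ofReal_vanDijkWeight_re_mul_le_of_hcBound`.
[cite: HarishChandra1999AdmissibleDistributions, Part III §16 Thm. 16.3] [cite: Rogawski1990, §12.7 Lemma 12.7.2 (proof) p. 193; §4.9 p. 54] -/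
theorem exists_bound_vanDijkWeight_re_mul_of_hcBounded (hHC : normalizedCharacter_locallyBoundedLeThree)
    (hns : ∀ w : PlacesOver L v, IsCMField.complexConj L • w.1 = w.1)
    [MeasurableSpace (Gqs L v)] [BorelSpace (Gqs L v)] (νQv : Measure (Gqs L v)) [νQv.IsHaarMeasure]
    (σ : IrrClass (Gqs L v)) (Θ : Gqs L v → ℂ) (hΘli : LocallyIntegrable Θ νQv)
    (hΘlc : ∀ x : Gqs L v, IsRegularElt (x.val : GL (Fin 3) (UnitaryGroup.LocalRing L v)) → ∀ᶠ y in 𝓝 x, Θ y = Θ x)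
    (hΘtr : ∀ φ : Gqs L v → ℂ, IsLocSmooth φ → σ.smoothTrace νQv φ = ∫ x, φ x * Θ x ∂νQv)
    {C : Set (Gqs L v)} (hC : IsCompact C) :
    ∃ B : ℝ, ∀ t : ↥(cmBorelTriple L 3 v).M,
      ((t : ↥(unitaryGroupOfForm (conjLocal L (IsCMField.complexConj L) v) (cmLocalForm L 3 v))) : Gqs L v) ∈ C →
        ‖(((vanDijkWeight L v t).re : ℝ) : ℂ) * Θ ((t : ↥(unitaryGroupOfForm (conjLocal L (IsCMField.complexConj L) v) (cmLocalForm L 3 v))) : Gqs L v)‖ ≤ B := by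
  obtain ⟨B, hB⟩ := hHC L 3 (by norm_num) le_rfl (qsForm L) (antidiagOne_isHermitian L 3) (isUnit_antidiagOne_det L 3).ne_zero v hns νQv σ Θ hΘli hΘlc hΘtr C hC
  exact ⟨max B 0, fun t ht => F0P3cStCharTSVanDijkHC.norm_ofReal_vanDijkWeight_re_mul_le_of_hcBound L v hns hB t ht⟩

/-! ## §2 (HCB σ): the bound on `M_c` for the datum's character `𝔇.char σ` -/

/-- **(HCB σ) of (TOR⁵) — `Re Δ(ι m) · χ_σ(ι m)` IS BOUNDED ON `M_c = 𝒪_vˣ × E¹_v`** (`v` NON-SPLIT), for every §12.5 datum `𝔇` on `U(Φ₃)(L⁺_v)` carrying (M1) ★ `CharRegularity` with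
`𝔇.μG = νQv` and `𝔇.regG ↔ IsRegularElt` (the organ's COMPAT clauses) and every square-integrable class `σ` (`𝔇.IsL2 σ`), GIVEN (F-b) `hHC`: §1 on the compact
`C := ι(M_c)` (★ `isCompact_torusCompactPart`, ★ `continuous_torusChart`).  The conclusion is the (HCB σ) clause of ★ ₈'s socket (TOR⁵) token for token.
[cite: Rogawski1990, §12.7 Lemma 12.7.2 (proof) p. 193] [cite: HarishChandra1999AdmissibleDistributions, Part III §16 Thm. 16.3] -/
theorem exists_bound_char_on_torusCompactPart (hHC : normalizedCharacter_locallyBoundedLeThree)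
    (hns : ∀ w : PlacesOver L v, IsCMField.complexConj L • w.1 = w.1)
    [MeasurableSpace (Gqs L v)] [BorelSpace (Gqs L v)]
    [∀ γ : Gqs L v, MeasurableSpace (Gqs L v ⧸ Subgroup.centralizer ({γ} : Set (Gqs L v)))] [MeasurableSpace (Gqs L v ⧸ Subgroup.center (Gqs L v))]
    {H : Type} [Group H] [TopologicalSpace H] [IsTopologicalGroup H] [MeasurableSpace H]
    (νQv : Measure (Gqs L v)) [νQv.IsHaarMeasure]
    (𝔇 : Ch12Sec5.EllipticData (Gqs L v) H) (hM1 : 𝔇.CharRegularity) (hμG : 𝔇.μG = νQv)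
    (hreg : ∀ γ : Gqs L v, γ ∈ 𝔇.regG ↔ IsRegularElt (γ.val : GL (Fin 3) (UnitaryGroup.LocalRing L v)))
    (σ : IrrClass (Gqs L v)) (hσ : 𝔇.IsL2 σ) :
    ∃ B : ℝ, ∀ m : ((UnitaryGroup.LocalRing L v)ˣ × ↥(normOneUnits (conjLocal L (IsCMField.complexConj L) v))),
      m ∈ (((Submonoid.pi Set.univ (fun w : PlacesOver L v => (w.1.adicCompletionIntegers L).toSubring.toSubmonoid)).units.prod (⊤ : Subgroup ↥(normOneUnits (conjLocal L (IsCMField.complexConj L) v)))) : Subgroup ((UnitaryGroup.LocalRing L v)ˣ × ↥(normOneUnits (conjLocal L (IsCMField.complexConj L) v)))) →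
        ‖(((vanDijkWeight L v (torusChart L v m)).re : ℝ) : ℂ) * 𝔇.char σ (((torusChart L v m : ↥(cmBorelTriple L 3 v).M) : ↥(unitaryGroupOfForm (conjLocal L (IsCMField.complexConj L) v) (cmLocalForm L 3 v))) : Gqs L v)‖ ≤ B := by
  obtain ⟨-, hli, hlc, htr⟩ := hM1 σ hσ
  rw [hμG] at hli htr
  have hlc' : ∀ x : Gqs L v, IsRegularElt (x.val : GL (Fin 3) (UnitaryGroup.LocalRing L v)) → ∀ᶠ y in 𝓝 x, 𝔇.char σ y = 𝔇.char σ x :=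
    fun x hx => hlc x ((hreg x).2 hx)
  -- the compact `ι(M_c)`
  have hι : Continuous fun m : ((UnitaryGroup.LocalRing L v)ˣ × ↥(normOneUnits (conjLocal L (IsCMField.complexConj L) v))) =>
      (((torusChart L v m : ↥(cmBorelTriple L 3 v).M) : ↥(unitaryGroupOfForm (conjLocal L (IsCMField.complexConj L) v) (cmLocalForm L 3 v))) : Gqs L v) :=
    continuous_subtype_val.comp (F0P3cStCharTSTorusChartIso.continuous_torusChart L v)
  have hC := (F0P3cStCharTSTorusCompactPart.isCompact_torusCompactPart L v hns).image hι
  obtain ⟨B, hB⟩ := exists_bound_vanDijkWeight_re_mul_of_hcBounded L v hHC hns νQv σ (𝔇.char σ) hli hlc' htr hC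
  exact ⟨B, fun m hm => hB (torusChart L v m) (Set.mem_image_of_mem _ hm)⟩

end Summit.HodgeConjecture.HodgeConjecture.Cruxes.H413.K2E3HbOnMcLeThree

end
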